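import Summits.ResolutionOfSingularities.ResolutionOfSingularities.Theorems.CuspCutKernels3
import HarnessLib

/-!
# CuspCutCells — decomp-res node «CuspCut» (lens-2 g24, critic row 197 BOOKED 0), tree file 4/6 of the node

Content VERBATIM from the decomp-res lens-2 g24 node `HOME/decomp-res-lens-2/g24/CuspCut.lean` (pin 4f3dedd1; no
carry, imports the landed tree only; ns `…Theses.CuspCut` ↦ `…Theorems.CuspCut`); HOME =
run/shared/lean/pub/decomp-res; critic CRITIC-LEDGER row 197 BOOKED 0; landing orders INBOX :1164 / :1194 —
provenance, critic text and the lens header in full in the first file of the node, `CuspCutKernels`.  `--kind proof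
--supports stmt-ResolutionOfSingularities-29273`.

## This file

§E.1 SCHEME LEVEL — the cusp class WITH TAILS `IsCuspAt` / `IsUniformCuspCurve`, the ENGINE `CuspExit` (untagged
`def … : Prop`, a HYPOTHESIS by name — cn26 advisory treatment as `DeepCrossExit`), the point class `IsCuspCurvePt`;
§E.1t THE TAME HALF (residue characteristic ≠ 2): `IsUniformTameCurve`, engine `TameTwoExit` (hypothesis by name),
`IsTameCurvePt`; §E.2 THE CUSP CUT — `IsCuspKindPt`, leaf `cuspLeaf = oddLeaf ∨ (E**)` + order lemmas, the located
residual class **`IsCuspSpecialPt`** (odd-special ∧ ¬(cusp-curve ∨ tame-curve)) with its readings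
`isCuspSpecialPt_iff_of_ringChar_eq_two` / `_ne_two`; `namespace CuspX` (cone-free part): §E.2b graded statements
`SeqCuspGen` / `SeqCuspSpec`, rungs `CuspGenRungAt` / **`CuspGenericRung`** / **`CuspSpecialRung`** (THE LOCATED
RESIDUAL of the lens-2 column after g24 — cone-free ASIDE HOME is this group) + `cuspGenericRung_iff` /
`cuspSpecialRung_iff`, §E.2c `section Kernels` (the kernels that do not name the host route).  Imports
`CuspCutKernels…` (last part).  (The 400-line cap cuts this group into 2 files; this first part carries: `IsCuspAt`,
`IsUniformCuspCurve`, `CuspExit`, `IsCuspCurvePt`, `eq_two_of_isUniformCuspCurve`, `eq_two_of_isCuspCurvePt`,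
`ringChar_eq_two_of_isUniformCuspCurve`, `three_le_of_isCuspAt`, `isCurveExitPt_of_isCuspCurvePt`,
`IsUniformTameCurve`, `TameTwoExit`, `IsTameCurvePt`, `eq_two_of_isTameCurvePt`,
`ringChar_ne_two_of_isUniformTameCurve`, `isCurveExitPt_of_isTameCurvePt`, `not_isTameCurvePt_of_isCuspCurvePt`,
`IsCuspKindPt`, `eq_two_of_isCuspKindPt`, `isCuspKindPt_iff_of_ringChar_eq_two`,
`isCuspKindPt_iff_of_ringChar_ne_two`, `cuspLeaf`, `oddLeaf_le_cuspLeaf`, `deepLeaf_le_cuspLeaf`,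
`cuspLeaf_of_isCuspCurvePt`, `cuspLeaf_of_isTameCurvePt`, `cuspLeaf_of_isCuspKindPt`, `IsCuspSpecialPt`,
`isSpecPt_cuspLeaf_iff`, `isOddSpecialPt_of_isCuspSpecialPt`, `isDeepSpecialPt_of_isCuspSpecialPt`,
`isOddSpecialPt_iff`, `isCuspSpecialPt_iff_of_ne_two`, `isCuspSpecialPt_iff_of_ringChar_eq_two`,
`isCuspSpecialPt_iff_of_ringChar_ne_two`.)

[WRITER NOTE (decomp-res writer g13): file split only (tree files ≤ 400 lines); sections, section variables / opens
and every declaration exactly as in the lens (the node's HOME-only dupNamespace-linter line is dropped; the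
namespace-level `open` lines of the node are replayed in every part, the `open …Theses` line only in the Theses-cone
file `MaxContactCutCuspCut`); namespace renamed `…Theses.CuspCut` ↦ `…Theorems.CuspCut`.]

(Sources: Hironaka1964 Ch. III; CossartJannsenSaito2020 Thm 5.9, Ch. 2, Ch. 8–9; Cutkosky2009 Thm 5.6, Thm 7.2,
Lemma 7.3, §8; Kollar2007 §3.13 (3.111); CossartPiltant2008 Prop. 4.2; CossartPiltant2019 Rem. 3.2;
EncinasVillamayor2000; BierstoneGrigorievMilmanWlodarczyk2011 §3.1; Moh1987; Hauser2010Kangaroo; Giraud1975.)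
-/

open CategoryTheory AlgebraicGeometry TopologicalSpace IsLocalRing
open Literature.AlgebraicGeometry.Resolution
open Summit.ResolutionOfSingularities.ResolutionOfSingularities.Theorems
open Summit.ResolutionOfSingularities.ResolutionOfSingularities.Theorems.WeakOrderReduction
open Summit.ResolutionOfSingularities.ResolutionOfSingularities.Theorems.DeltaFaceCutClasses
open Summit.ResolutionOfSingularities.ResolutionOfSingularities.Theorems.RelativeDeltaCut
open Summit.ResolutionOfSingularities.ResolutionOfSingularities.Theorems.CurveLeafExit
open Summit.ResolutionOfSingularities.ResolutionOfSingularities.Theorems.PinchCut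
open Summit.ResolutionOfSingularities.ResolutionOfSingularities.Theorems.JetCut
open Summit.ResolutionOfSingularities.ResolutionOfSingularities.Theorems.PurityCut
open Summit.ResolutionOfSingularities.ResolutionOfSingularities.Theorems.SplitCut
open Summit.ResolutionOfSingularities.ResolutionOfSingularities.Theorems.CylinderCut
open Summit.ResolutionOfSingularities.ResolutionOfSingularities.Theorems.SpreadCut
open Summit.ResolutionOfSingularities.ResolutionOfSingularities.Theorems.CrossCut
open Summit.ResolutionOfSingularities.ResolutionOfSingularities.Theorems.DeepCrossCut
open Summit.ResolutionOfSingularities.ResolutionOfSingularities.Theorems.OddCrossCut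

namespace Summit.ResolutionOfSingularities.ResolutionOfSingularities.Theorems.CuspCut

/-! ## §E.1  SCHEME LEVEL — the cusp class WITH TAILS, the ENGINE `CuspExit`, the decided-side class -/

/-- **CUSP-SHAPED at `y` transversal to `η` with degree `m`** (`IsCuspAt I m η y`; marking `2`): regular parameters
`c = (z̃, u₁, u₂)` of `𝒪_{Y,y}` generating the curve prime `curvePrime (η ⤳ y)`, an inert parameter `v` completing
them to a minimal system of `𝔪_y` (`spanFinrank = 4`), the stalk ideal PRINCIPAL `I_y = (f)` (the non-principal
case is the critic's window (b), excluded BY LETTER), and `f` of CUSP SHAPE (`CuspShape (curvePrime h) 𝔪_y c G g f m`: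
corner `z̃²`, `C`-relative face a binary form of odd degree `m = 2q+1 ≥ 3` in `(u₁,u₂)` with coefficients in
`𝒪_{Y,y}`, tail strictly above the face, secondary curve CUSP-OR-SIMPLE over `y` in both charts).  INSEP-v³ at its
core: `represent_INSEPv3` + `cuspShape_pure` (`m = 5`, `t = v`, `b = 3`).  DEFINITION (NEW class predicate).
(Sources: Hironaka1967; CossartJannsenSaito2020 Ch. 8; CossartPiltant2008 Prop. 4.2; Moh1987.) -/
def IsCuspAt {Y : Scheme.{0}} (I : Y.IdealSheafData) (m : ℕ) (η y : Y) : Prop :=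
  ∃ h : η ⤳ y, ∃ (c : Fin 3 → Y.presheaf.stalk y) (v g f : Y.presheaf.stalk y) (G : ℕ → Y.presheaf.stalk y),
    Ideal.span (Set.range c) = curvePrime h ∧
      Ideal.span (Set.range c ∪ {v}) = maximalIdeal (Y.presheaf.stalk y) ∧
      (maximalIdeal (Y.presheaf.stalk y)).spanFinrank = 4 ∧
      stalkIdeal I y = Ideal.span {f} ∧
      CuspShape (curvePrime h) (maximalIdeal (Y.presheaf.stalk y)) c G g f m

/-- **UNIFORMLY CUSP-SHAPED CURVE of degree `m`** (`IsUniformCuspCurve I n m η`): the marking is `n = 2`, `η` is a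
curve point, and EVERY closed point `y` of `closure {η}` has RESIDUE CHARACTERISTIC `2` (the letter of the ω-game:
`f = Z² + F` purely inseparable — the SPECIAL side of the dichotomy; the residue-characteristic-`≠ 2` members of the
cuspidal kind — the critic's corner39 over `𝔽₃` among them — form the TAME class `IsUniformTameCurve` of §E.1t,
NODE-g24 §9) and is cusp-shaped transversal to `η`
with the same `m`.  The hypothesis of ENGINE (E**).  DEFINITION (NEW class predicate). -/
def IsUniformCuspCurve {Y : Scheme.{0}} (I : Y.IdealSheafData) (n m : ℕ) (η : Y) : Prop :=
  n = 2 ∧ IsCurvePt η ∧ ∀ y : Y, η ⤳ y → IsClosed ({y} : Set Y) →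
    ringChar (ResidueField (Y.presheaf.stalk y)) = 2 ∧ IsCuspAt I m η y

/-- **ENGINE (E**) `CuspExit`** [TYPED · kept as a HYPOTHESIS · paper decision = NODE-g24 §1–§5: after the g19 tower
`C, Σ₁, …, Σ_{q−1}` (unchanged: it only reads the face) the top locus over `C` at stage `q` is the secondary curve
`Γ ⊂ Σ_q`, regular except at finitely many CUSP POINTS `x̄` (the new letter), where the strict transform reads
`Z² + F(u, s, t)` (`u` = the equation of `Σ_q`'s exceptional component, `(s,t)` parameters of `Σ_q` at `x̄`,
`F = u·φ(s,t) + u²·ψ + …`, `φ` = the cusp `e₁sᵃ + e₂tᵇ + (above the edge)`); Top-isolation of `closure {η}` makes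
`Top(Z²+F) ⊂ Σ̃_q ∪ (exceptional)` LEGITIMATE for the ω-game; the exit package is the blow-up sequence chosen by
RULE 𝓡 in its global form; for the certified inhabitant the whole package is the 40-node tree of `section Pilot`
(kernel); for the kind: strategy + 175-germ evidence + measure conjecture, termination proof OPEN (cleanup lemma
T2)] : on a regular scheme, a Top-isolated uniformly cusp-shaped curve has an exit package with centres over it.
STATEMENT (engine). (Sources: Hironaka1964 Ch. III; CossartJannsenSaito2020 Ch. 2, Ch. 8–9; CossartPiltant2008
Prop. 4.2; Hauser2010Kangaroo; Moh1987; BierstoneGrigorievMilmanWlodarczyk2011 §3.) -/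
def CuspExit : Prop :=
  ∀ (Y : Scheme.{0}), Scheme.IsRegular Y → ∀ (I : Y.IdealSheafData) (n m : ℕ) (η : Y),
    IsUniformCuspCurve I n m η → IsTopIsolatedClosure I n η → PackageExitsOver I n {y : Y | η ⤳ y}

/-- **CUSP-CURVE point** (NEW DECIDED-SIDE CLASS, leaf (E**)): `y` lies on (or is the generic point of) a Top-isolated,
uniformly cusp-shaped curve.  Inhabitant: the core of INSEP-v³ (the window's certified inhabitant) — and every point
of its top curve.  DEFINITION (NEW class). -/
def IsCuspCurvePt {Y : Scheme.{0}} (I : Y.IdealSheafData) (n : ℕ) (y : Y) : Prop :=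
  ∃ (η : Y) (m : ℕ), η ⤳ y ∧ IsTopIsolatedClosure I n η ∧ IsUniformCuspCurve I n m η

/-- The cusp letter is a marking-`2` letter.  KERNEL (PROVED). [folklore] -/
theorem eq_two_of_isUniformCuspCurve {Y : Scheme.{0}} {I : Y.IdealSheafData} {n m : ℕ} {η : Y}
    (h : IsUniformCuspCurve I n m η) : n = 2 :=
  h.1

/-- The cusp-curve class lives at marking `2` only.  KERNEL (PROVED). [folklore] -/
theorem eq_two_of_isCuspCurvePt {Y : Scheme.{0}} {I : Y.IdealSheafData} {n : ℕ} {y : Y}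
    (h : IsCuspCurvePt I n y) : n = 2 := by
  obtain ⟨η, m, _, _, hc⟩ := h
  exact hc.1

/-- At a closed point of a uniformly cusp-shaped curve the residue characteristic is `2` (the guard, read off the
letter).  KERNEL (PROVED). [folklore] -/
theorem ringChar_eq_two_of_isUniformCuspCurve {Y : Scheme.{0}} {I : Y.IdealSheafData} {n m : ℕ} {η y : Y}
    (h : IsUniformCuspCurve I n m η) (hy : η ⤳ y) (hcl : IsClosed ({y} : Set Y)) :
    ringChar (ResidueField (Y.presheaf.stalk y)) = 2 :=
  (h.2.2 y hy hcl).1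

/-- The cusp letter at a closed point names a degree `m = 2q + 1 ≥ 3`.  KERNEL (PROVED; letter bookkeeping used by
the probes). [folklore] -/
theorem three_le_of_isCuspAt {Y : Scheme.{0}} {I : Y.IdealSheafData} {m : ℕ} {η y : Y} (h : IsCuspAt I m η y) :
    3 ≤ m := by
  obtain ⟨_, c, v, g, f, G, _, _, _, _, hshape⟩ := h
  obtain ⟨_, _, ⟨q, hq, hm⟩, _, _⟩ := hshape
  omega

/-- **Under ENGINE (E**), every cusp-curve point is a curve-exit point of g12's port** (no new port).  KERNEL
(PROVED). [folklore] -/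
theorem isCurveExitPt_of_isCuspCurvePt {Y : Scheme.{0}} {I : Y.IdealSheafData} {n : ℕ} {y : Y}
    (hE : CuspExit) (hY : Scheme.IsRegular Y) (h : IsCuspCurvePt I n y) : IsCurveExitPt I n y := by
  obtain ⟨η, m, hηy, hiso, hcurve⟩ := h
  exact ⟨η, hηy, hcurve.2.1, hiso, hE Y hY I n m η hcurve hiso⟩

/-! ### §E.1t  THE TAME HALF OF THE DICHOTOMY (residue characteristic ≠ 2; NODE-g24 §9) -/

/-- **UNIFORMLY TAME CURVE** (`IsUniformTameCurve I n η`; the GENERIC side of the structural dichotomy «residue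
characteristic `= n` (special, wild) vs `≠ n` (generic, tame)» at marking `n = 2`): `η` is a curve point and at EVERY
closed point `y` of `closure {η}` the residue characteristic is `≠ 2`, the stalk ideal is PRINCIPAL and of order `2`.
NO SHAPE LETTER: cusp-shaped (the critic's corner39 over `𝔽₃`), δ-, spread-, cross-shaped or none — the tame members of
EVERY principal marking-2 curve kind of the column.  DEFINITION (NEW class predicate). -/
def IsUniformTameCurve {Y : Scheme.{0}} (I : Y.IdealSheafData) (n : ℕ) (η : Y) : Prop :=
  n = 2 ∧ IsCurvePt η ∧ ∀ y : Y, η ⤳ y → IsClosed ({y} : Set Y) →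
    ringChar (ResidueField (Y.presheaf.stalk y)) ≠ 2 ∧
      (∃ f : Y.presheaf.stalk y, stalkIdeal I y = Ideal.span {f}) ∧ idealOrder I y = ((2 : ℕ) : ℕ∞)

/-- **ENGINE (T) `TameTwoExit`** [TYPED · kept as a HYPOTHESIS (like (X**) (X***) (E**)) · REDUCED ON PAPER TO PRINT in
the pointwise case over perfect ground fields; remaining items ρ1–ρ4 listed in NODE-g24 §9.5]: `2` is a unit, so in the
completed local ring of every point of order `2`, `f = v·(Z² + F(x))` (TAME maximal contact, order `2 <` residue
characteristic: Cohen + Weierstrass + Tschirnhausen; the `Z`-chart of every centre is empty — `corner_zroot` — and the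
strict transforms of `H = {Z = 0}` stay Tschirnhausen hypersurfaces at every later stage), `Sing₂(f) = {ord F ≥ 2}`, at
a point of order `2` `τ ≥ 2 ⟺ ord F = 2`, and a weakly admissible blow-up acts by `F ↦ F∘σ/x²`: the exit package is
ORDER REDUCTION OF `F` BELOW `3` by regular centres inside `{ord F ≥ 2}` on the regular threefold germ `H`.  REDUCTION
(§9.3, in the presentation fixed once per bad point): write the transform as `F = J·Π x_E^{c_E}`; (A) Cutkosky2009
Thm 5.6 with the canonical algorithm of its §8 (blow up the curves of `Sing_r(J)`, else its points; preparation
Thm 7.2), by descending induction on `r = max ord J` down to `r = 2`, keeps the exceptional divisors snc and has all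
centres in `Sing_r(J) ⊆ {ord F ≥ 2}`; (B) Cutkosky2009 Lemma 7.3 applied to the regular surface `V(J)` and ONLY the
exceptional components with `c_E ≥ 1` (centres in their intersection, where `ord F ≥ 2`; the components with `c_E = 0`
never enter `F` and are ignored — separating from them would need inadmissible centres); (C) the monomial phase
(Kollar2007 3.111.3) on `unit·J·Π x_E^{c_E}`, centres = snc strata of exponent sum `≥ 3`.  EXCHANGE LEMMA (§9.2, new,
characteristic `≠ 2`, any residue field): two Tschirnhausen presentations have `F' = w·(F∘ψ)` with
`ψ ≡ id mod (F, ∇F)`, so the numbers `ord_P F`, `P ∈ Sing₂(f)`, and the loci `Sing_r`, `r ≥ 2`, are INTRINSIC — the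
input for running (A) by globally defined centres along a curve of bad points.  STATUS: when `τ(η) ≥ 2` the bad points
over the curve are finitely many closed points and (A)–(C) apply to each separately — in print over an algebraically
closed field (Cutkosky2009 is stated for varieties, the argument of its §6–10 is formal-local: ρ2), perfect fields by
Galois descent (ρ3; IMPERFECT fields need the excellent-scheme form of Thm 5.6 = the cell's standing port family L —
CossartJannsenSaito2020 is the strict-transform version); when `τ(η) = 1` a generic surface phase along the curve comes
first (ρ1); the bookkeeping of (B) is ρ4.  NOT AVAILABLE at residue characteristic `2`, where `F` is defined modulo
squares only, `Sing₂(f) = V(∇F)` and `V(F)` is not an invariant — that is (E**) proper, the ω-game.  KERNEL PILOT: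
corner39, `section Corner` (the same rule 𝓡, exact game, 2 rounds)] : on a regular scheme, a Top-isolated uniformly
tame curve has an exit package with centres over it.  STATEMENT (engine).  (Sources: Cutkosky2009 Thm 5.6, Thm 7.2,
Lemma 7.3, §8; Kollar2007 §3.13 (3.111.3); CossartJannsenSaito2020 Thm 5.9; EncinasVillamayor2000; Giraud1975;
Hironaka1967; BierstoneGrigorievMilmanWlodarczyk2011 §3.1, §5.) -/
def TameTwoExit : Prop :=
  ∀ (Y : Scheme.{0}), Scheme.IsRegular Y → ∀ (I : Y.IdealSheafData) (n : ℕ) (η : Y),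
    IsUniformTameCurve I n η → IsTopIsolatedClosure I n η → PackageExitsOver I n {y : Y | η ⤳ y}

/-- **TAME-CURVE point** (NEW DECIDED-SIDE CLASS, leaf (T)): `y` lies on (or is the generic point of) a Top-isolated
uniformly tame curve.  Inhabitant: the cusp point of corner39 — and every point of its top curve.  DEFINITION (NEW
class). -/
def IsTameCurvePt {Y : Scheme.{0}} (I : Y.IdealSheafData) (n : ℕ) (y : Y) : Prop :=
  ∃ η : Y, η ⤳ y ∧ IsTopIsolatedClosure I n η ∧ IsUniformTameCurve I n η

/-- The tame letter is a marking-`2` letter.  KERNEL (PROVED). [folklore] -/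
theorem eq_two_of_isTameCurvePt {Y : Scheme.{0}} {I : Y.IdealSheafData} {n : ℕ} {y : Y}
    (h : IsTameCurvePt I n y) : n = 2 := by
  obtain ⟨η, _, _, hc⟩ := h
  exact hc.1

/-- At a closed point of a uniformly tame curve the residue characteristic is `≠ 2` (the guard, read off the letter).
KERNEL (PROVED). [folklore] -/
theorem ringChar_ne_two_of_isUniformTameCurve {Y : Scheme.{0}} {I : Y.IdealSheafData} {n : ℕ} {η y : Y}
    (h : IsUniformTameCurve I n η) (hy : η ⤳ y) (hcl : IsClosed ({y} : Set Y)) :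
    ringChar (ResidueField (Y.presheaf.stalk y)) ≠ 2 :=
  (h.2.2 y hy hcl).1

/-- **Under ENGINE (T), every tame-curve point is a curve-exit point of g12's port** (no new port).  KERNEL (PROVED).
[folklore] -/
theorem isCurveExitPt_of_isTameCurvePt {Y : Scheme.{0}} {I : Y.IdealSheafData} {n : ℕ} {y : Y}
    (hE : TameTwoExit) (hY : Scheme.IsRegular Y) (h : IsTameCurvePt I n y) : IsCurveExitPt I n y := by
  obtain ⟨η, hηy, hiso, hcurve⟩ := h
  exact ⟨η, hηy, hcurve.2.1, hiso, hE Y hY I n η hcurve hiso⟩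

/-- **THE TWO HALVES ARE DISJOINT AT CLOSED POINTS** (special vs generic is a partition where both are read: a closed
point of a uniformly cusp curve has residue characteristic `2`, of a uniformly tame curve `≠ 2`).  KERNEL (PROVED).
[folklore] -/
theorem not_isTameCurvePt_of_isCuspCurvePt {Y : Scheme.{0}} {I : Y.IdealSheafData} {n : ℕ} {y : Y}
    (hcl : IsClosed ({y} : Set Y)) (h : IsCuspCurvePt I n y) : ¬ IsTameCurvePt I n y := by
  rintro ⟨η', hη'y, _, ht⟩
  obtain ⟨η, m, hηy, _, hc⟩ := h
  exact ringChar_ne_two_of_isUniformTameCurve ht hη'y hcl (ringChar_eq_two_of_isUniformCuspCurve hc hηy hcl)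

/-- **CUSPIDAL-KIND point** of g24 = wild (E**) ∨ tame (T): the two sides of the structural dichotomy, the decided
side of the cut.  DEFINITION (NEW class). -/
def IsCuspKindPt {Y : Scheme.{0}} (I : Y.IdealSheafData) (n : ℕ) (y : Y) : Prop :=
  IsCuspCurvePt I n y ∨ IsTameCurvePt I n y

/-- The cuspidal kind lives at marking `2`.  KERNEL (PROVED). [folklore] -/
theorem eq_two_of_isCuspKindPt {Y : Scheme.{0}} {I : Y.IdealSheafData} {n : ℕ} {y : Y}
    (h : IsCuspKindPt I n y) : n = 2 :=
  h.elim (fun h => eq_two_of_isCuspCurvePt h) (fun h => eq_two_of_isTameCurvePt h)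

/-- **DICHOTOMY, special side**: at a closed point of residue characteristic `2` the kind IS the wild class.
KERNEL (PROVED). [folklore] -/
theorem isCuspKindPt_iff_of_ringChar_eq_two {Y : Scheme.{0}} {I : Y.IdealSheafData} {n : ℕ} {y : Y}
    (hcl : IsClosed ({y} : Set Y)) (h2 : ringChar (ResidueField (Y.presheaf.stalk y)) = 2) :
    IsCuspKindPt I n y ↔ IsCuspCurvePt I n y := by
  refine ⟨fun h => h.elim id fun ht => ?_, Or.inl⟩
  obtain ⟨η, hηy, _, hc⟩ := ht
  exact absurd h2 (ringChar_ne_two_of_isUniformTameCurve hc hηy hcl)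

/-- **DICHOTOMY, generic side**: at a closed point of residue characteristic `≠ 2` the kind IS the tame class.
KERNEL (PROVED). [folklore] -/
theorem isCuspKindPt_iff_of_ringChar_ne_two {Y : Scheme.{0}} {I : Y.IdealSheafData} {n : ℕ} {y : Y}
    (hcl : IsClosed ({y} : Set Y)) (h2 : ringChar (ResidueField (Y.presheaf.stalk y)) ≠ 2) :
    IsCuspKindPt I n y ↔ IsTameCurvePt I n y := by
  refine ⟨fun h => h.elim (fun hc => ?_) id, Or.inr⟩
  obtain ⟨η, m, hηy, _, hu⟩ := hc
  exact absurd (ringChar_eq_two_of_isUniformCuspCurve hu hηy hcl) h2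

/-! ## §E.2  THE CUSP CUT — leaf `cuspLeaf = oddLeaf ∨ (E**)`, the located residual class `IsCuspSpecialPt`, the
rungs (instances of the tree's §G `Leaf` schema over g20's COMPONENT port), `CuspX.closes` BY NAME, the engines at work -/

/-- The CUSP leaf of g24: odd leaf (tree, g23) ∨ cuspidal-kind point (wild ∨ tame).  DEFINITION (leaf instance).
[folklore] -/
def cuspLeaf : ∀ ⦃Y : Scheme.{0}⦄, Y.IdealSheafData → ℕ → Y → Prop :=
  fun _ I n y => oddLeaf I n y ∨ IsCuspKindPt I n y

/-- The odd leaf is inside the cusp leaf. [folklore] -/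
theorem oddLeaf_le_cuspLeaf ⦃Y : Scheme.{0}⦄ (I : Y.IdealSheafData) (n : ℕ) (y : Y) :
    oddLeaf I n y → cuspLeaf I n y :=
  fun h => Or.inl h

/-- The deep leaf (g21/g22) is inside the cusp leaf. [folklore] -/
theorem deepLeaf_le_cuspLeaf ⦃Y : Scheme.{0}⦄ (I : Y.IdealSheafData) (n : ℕ) (y : Y) :
    deepLeaf I n y → cuspLeaf I n y :=
  fun h => Or.inl (deepLeaf_le_oddLeaf I n y h)

/-- A cusp-curve point is in the cusp leaf. [folklore] -/
theorem cuspLeaf_of_isCuspCurvePt ⦃Y : Scheme.{0}⦄ {I : Y.IdealSheafData} {n : ℕ} {y : Y}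
    (h : IsCuspCurvePt I n y) : cuspLeaf I n y :=
  Or.inr (Or.inl h)

/-- A tame-curve point is in the cusp leaf. [folklore] -/
theorem cuspLeaf_of_isTameCurvePt ⦃Y : Scheme.{0}⦄ {I : Y.IdealSheafData} {n : ℕ} {y : Y}
    (h : IsTameCurvePt I n y) : cuspLeaf I n y :=
  Or.inr (Or.inr h)

/-- A cuspidal-kind point is in the cusp leaf. [folklore] -/
theorem cuspLeaf_of_isCuspKindPt ⦃Y : Scheme.{0}⦄ {I : Y.IdealSheafData} {n : ℕ} {y : Y}
    (h : IsCuspKindPt I n y) : cuspLeaf I n y :=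
  Or.inr h

/-- **THE LOCATED RESIDUAL CLASS of g24** (`IsCuspSpecialPt`): odd-special (tree, g23) and NOT of the cuspidal kind
(neither a wild cusp-curve point nor a tame-curve point).  DEFINITION (NEW class; UNDECIDED · IDEA-NEEDED). [folklore] -/
def IsCuspSpecialPt {k : Type} [Field k] {Y : Scheme.{0}} (g : Y ⟶ Spec (.of k)) (hY : Scheme.IsRegular Y)
    (I : Y.IdealSheafData) (n : ℕ) (y : Y) : Prop :=
  IsOddSpecialPt g hY I n y ∧ ¬ IsCuspKindPt I n y

/-- Pointwise: the cusp-special class IS the `cuspLeaf`-special class of §G.  KERNEL (PROVED). [folklore] -/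
theorem isSpecPt_cuspLeaf_iff {k : Type} [Field k] {Y : Scheme.{0}} (g : Y ⟶ Spec (.of k)) (hY : Scheme.IsRegular Y)
    (I : Y.IdealSheafData) (n : ℕ) (y : Y) : Leaf.IsSpecPt cuspLeaf g hY I n y ↔ IsCuspSpecialPt g hY I n y := by
  constructor
  · rintro ⟨hL, hno⟩
    exact ⟨(isSpecPt_oddLeaf_iff g hY I n y).mp ⟨hL, fun h => hno (Or.inl h)⟩, fun h => hno (Or.inr h)⟩
  · rintro ⟨hS, hO⟩
    obtain ⟨hL, hno⟩ := (isSpecPt_oddLeaf_iff g hY I n y).mpr hS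
    refine ⟨hL, ?_⟩
    rintro (h | h)
    · exact hno h
    · exact hO h

/-- The cusp-special class is contained in g23's odd-special class (the residual SHRINKS by letter).  KERNEL (PROVED).
[folklore] -/
theorem isOddSpecialPt_of_isCuspSpecialPt {k : Type} [Field k] {Y : Scheme.{0}} {g : Y ⟶ Spec (.of k)}
    {hY : Scheme.IsRegular Y} {I : Y.IdealSheafData} {n : ℕ} {y : Y} (h : IsCuspSpecialPt g hY I n y) :
    IsOddSpecialPt g hY I n y :=
  h.1

/-- … and hence in g22's deep-special class.  KERNEL (PROVED). [folklore] -/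
theorem isDeepSpecialPt_of_isCuspSpecialPt {k : Type} [Field k] {Y : Scheme.{0}} {g : Y ⟶ Spec (.of k)}
    {hY : Scheme.IsRegular Y} {I : Y.IdealSheafData} {n : ℕ} {y : Y} (h : IsCuspSpecialPt g hY I n y) :
    IsDeepSpecialPt g hY I n y :=
  h.1.1

/-- **EXACT POINTWISE DICHOTOMY of g23's residual class** (the structural dichotomy at a point, g24): odd-special ⟺
(odd-special and of the cuspidal kind — engine side (E**) ∨ (T)) ∨ cusp-special.  KERNEL (PROVED). [folklore] -/
theorem isOddSpecialPt_iff {k : Type} [Field k] {Y : Scheme.{0}} (g : Y ⟶ Spec (.of k)) (hY : Scheme.IsRegular Y)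
    (I : Y.IdealSheafData) (n : ℕ) (y : Y) :
    IsOddSpecialPt g hY I n y ↔
      (IsOddSpecialPt g hY I n y ∧ IsCuspKindPt I n y) ∨ IsCuspSpecialPt g hY I n y := by
  constructor
  · intro h
    by_cases ho : IsCuspKindPt I n y
    · exact Or.inl ⟨h, ho⟩
    · exact Or.inr ⟨h, ho⟩
  · rintro (⟨h, _⟩ | ⟨h, _⟩) <;> exact h

/-- At markings `n ≠ 2` the cusp-special class IS the odd-special class (the new letter is a marking-`2` letter).
KERNEL (PROVED). [folklore] -/
theorem isCuspSpecialPt_iff_of_ne_two {k : Type} [Field k] {Y : Scheme.{0}} (g : Y ⟶ Spec (.of k))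
    (hY : Scheme.IsRegular Y) (I : Y.IdealSheafData) {n : ℕ} (hn : n ≠ 2) (y : Y) :
    IsCuspSpecialPt g hY I n y ↔ IsOddSpecialPt g hY I n y :=
  ⟨fun h => h.1, fun h => ⟨h, fun hc => hn (eq_two_of_isCuspKindPt hc)⟩⟩

/-- **THE RESIDUAL AT A CLOSED POINT OF RESIDUE CHARACTERISTIC 2** (special side): odd-special and not a wild
cusp-curve point.  KERNEL (PROVED). [folklore] -/
theorem isCuspSpecialPt_iff_of_ringChar_eq_two {k : Type} [Field k] {Y : Scheme.{0}} (g : Y ⟶ Spec (.of k))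
    (hY : Scheme.IsRegular Y) (I : Y.IdealSheafData) (n : ℕ) {y : Y} (hcl : IsClosed ({y} : Set Y))
    (h2 : ringChar (ResidueField (Y.presheaf.stalk y)) = 2) :
    IsCuspSpecialPt g hY I n y ↔ IsOddSpecialPt g hY I n y ∧ ¬ IsCuspCurvePt I n y :=
  and_congr Iff.rfl (isCuspKindPt_iff_of_ringChar_eq_two hcl h2).not

/-- **THE RESIDUAL AT A CLOSED POINT OF RESIDUE CHARACTERISTIC ≠ 2** (generic side): odd-special and not a tame-curve
point — every principal, order-2, Top-isolated curve point there is on the DECIDED side (engine (T), on paper by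
citation).  KERNEL (PROVED). [folklore] -/
theorem isCuspSpecialPt_iff_of_ringChar_ne_two {k : Type} [Field k] {Y : Scheme.{0}} (g : Y ⟶ Spec (.of k))
    (hY : Scheme.IsRegular Y) (I : Y.IdealSheafData) (n : ℕ) {y : Y} (hcl : IsClosed ({y} : Set Y))
    (h2 : ringChar (ResidueField (Y.presheaf.stalk y)) ≠ 2) :
    IsCuspSpecialPt g hY I n y ↔ IsOddSpecialPt g hY I n y ∧ ¬ IsTameCurvePt I n y :=
  and_congr Iff.rfl (isCuspKindPt_iff_of_ringChar_ne_two hcl h2).not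

end Summit.ResolutionOfSingularities.ResolutionOfSingularities.Theorems.CuspCut
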